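import Literature.Computability.AlgebraicComplexity.LandsbergRessayreNormalForm
import Literature.Computability.AlgebraicComplexity.VonZurGathenSingPermHeight
import Literature.Computability.AlgebraicComplexity.PencilFamily
import Mathlib.RingTheory.Ideal.KrullsHeightTheorem
import Mathlib.LinearAlgebra.Matrix.ToLinearEquiv
import Mathlib.Analysis.Complex.Polynomial.Basic

/-!
# `UlrichPadded.OrbitCorankTwo` (stmt-ValiantsHypothesis-15032), line `SketchIdeator1`:
# stub S4 `orbitCorankTwo_levelledCorankTwo` — levelled representations have `adj (lin A) = 0`

The statement is, verbatim, the body of the route support item `LevelledCorankTwo`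
(stmt-ValiantsHypothesis-15033): for `n ≥ 3`, if an affine determinantal representation
`A = A₀ + L` of `per_n` (size `m`) admits integer weights `α` (rows), `β` (columns) with
`α i + β j = 0` on the support of the constant part `A₀` and `α i + β j = 1` on the support of the
linear part `L`, then `adj L = 0` identically.

Proof (Cruxes/NoTightInfinity/Ideas/homothety-lift-grading.md, Lever (1)–(3), with the level
count reorganised through partial sums, which avoids ranks over `ℂ(x)` and rank additivity of
block-diagonal matrices).  Column `j` has level `β j`, row `i` has level `-α i`; `A₀` preserves
levels and `L` lowers them by one.  Write `N_c(θ) = #{j : β j ≤ θ}`, `N_r(θ) = #{i : -α i ≤ θ}`.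

1. *Zero blocks.* If the columns in `S` of a square matrix are supported in the rows `T` and
   `|T| < |S|`, the determinant vanishes (every Leibniz term has a factor `M (σ j) j = 0`,
   pigeonhole); with `|T| + 2 ≤ |S|` every submaximal minor vanishes (`adj = 0`).
2. `adj A₀ ≠ 0`: von zur Gathen 1987, Thm. 3.1 at the origin
   (`VonZurGathen.false_of_adjugate_eval_eq_zero`, both height facts PROVED in tree).  The rows of
   level `≤ θ` of `A₀` live in the columns of level `≤ θ`, so by 1: `N_r(θ) ≤ N_c(θ) + 1`.
3. `det A₀ = per_n(0) = 0` gives `w ≠ 0` with `wᵀ A₀ = 0`; its restriction `w₀` to the row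
   level of an index `i₁` with `w i₁ ≠ 0` is still a left null vector (`A₀` is level-diagonal).
   The row `b := w₀ᵀ L = w₀ᵀ A` consists of linear forms supported on the columns of level
   `1 - α i₁`, and Cramer (`b · adj A = per_n · w₀ᵀ`) puts `per_n` in the ideal of the `b j`.
4. `per_n` (`n ≥ 3`) lies in no ideal generated by two linear forms: from `per_n = Σ ℓ_j g_j`
   with `g_j` homogeneous of degree `n - 1`, the ideal `J = (ℓ_j, g_j)` has `≤ 4` generators,
   no constant terms (so `J ≠ ⊤`), and contains `per_n` and all `∂ per_n`; a minimal prime of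
   `J` has height `≤ 4` (Krull's height theorem) and `≥ 5` (von zur Gathen 1987, Lemma 2.3,
   `VonZurGathen.vonzurGathen1987_singPerm_height_holds`).  Hence level `1 - α i₁` has `≥ 3`
   columns.
5. So `N_c(1 - α i₁) ≥ N_c(-α i₁) + 3 ≥ N_r(-α i₁) + 2`, while the columns of `L` of level
   `≤ 1 - α i₁` live in the rows of level `≤ -α i₁`: by 1, `adj L = 0`.
-/

noncomputable section

namespace Summit.ValiantsHypothesis.Theorems

open MvPolynomial Matrix
open Literature.Computability.AlgebraicComplexity

section ZeroBlock

variable {R : Type*} [CommRing R] {ι : Type*} [Fintype ι] [DecidableEq ι]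

/-- **Zero blocks kill determinants.** If the columns in `S` of a square matrix `M` are supported
in the rows `T` and `|T| < |S|`, then `det M = 0`: every term of the Leibniz expansion has a
factor `M (σ j) j = 0` with `j ∈ S`, `σ j ∉ T` (pigeonhole). [folklore] -/
theorem levelled_det_eq_zero_of_colBlock (M : Matrix ι ι R) (S T : Finset ι)
    (hST : T.card < S.card) (hz : ∀ i j, j ∈ S → i ∉ T → M i j = 0) : M.det = 0 := by
  rw [Matrix.det_apply']
  refine Finset.sum_eq_zero fun σ _ => ?_
  obtain ⟨j, hjS, hj⟩ : ∃ j ∈ S, σ j ∉ T := by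
    by_contra h
    refine absurd (Finset.card_le_card_of_injOn σ (fun j hj => ?_) σ.injective.injOn)
      (not_le.2 hST)
    by_contra hjT
    exact h ⟨j, hj, hjT⟩
  rw [Finset.prod_eq_zero (f := fun i => M (σ i) i) (Finset.mem_univ j) (hz _ _ hjS hj), mul_zero]

/-- With two rows to spare (`|T| + 2 ≤ |S|`, columns in `S` supported in the rows `T`) every
submaximal minor vanishes: `adj M = 0`. [folklore] -/
theorem levelled_adjugate_eq_zero_of_colBlock (M : Matrix ι ι R) (S T : Finset ι)
    (hST : T.card + 2 ≤ S.card) (hz : ∀ i j, j ∈ S → i ∉ T → M i j = 0) : M.adjugate = 0 := by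
  ext p q
  rw [Matrix.adjugate_apply, Matrix.zero_apply]
  refine levelled_det_eq_zero_of_colBlock _ S (insert q T)
    (lt_of_le_of_lt (Finset.card_insert_le q T) (by omega)) fun i j hj hi => ?_
  rw [Finset.mem_insert, not_or] at hi
  rw [Matrix.updateRow_ne hi.1]
  exact hz i j hj hi.2

/-- Row version: if the rows in `S` are supported in the columns `T` and `|T| + 2 ≤ |S|`, then
`adj M = 0`. [folklore] -/
theorem levelled_adjugate_eq_zero_of_rowBlock (M : Matrix ι ι R) (S T : Finset ι)
    (hST : T.card + 2 ≤ S.card) (hz : ∀ i j, i ∈ S → j ∉ T → M i j = 0) : M.adjugate = 0 := by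
  have h := levelled_adjugate_eq_zero_of_colBlock Mᵀ S T hST fun i j hj hi => hz j i hj hi
  rwa [← Matrix.adjugate_transpose, Matrix.transpose_eq_zero] at h

end ZeroBlock

/-- A homogeneous polynomial of positive degree has no constant term. [folklore] -/
theorem levelled_constantCoeff_eq_zero_of_isHomogeneous {σ : Type*} {K : Type*} [CommSemiring K]
    {p : MvPolynomial σ K} {d : ℕ} (hp : p.IsHomogeneous d) (hd : d ≠ 0) :
    constantCoeff p = 0 := by
  rw [constantCoeff_eq]
  exact hp.coeff_eq_zero (by rw [map_zero]; exact fun h => hd h.symm)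

/-- **`per_n` is in no ideal generated by two linear forms** (`n ≥ 3`): if `per_n ∈ (ℓ_j)_j` for
linear forms `ℓ_j`, then at least three `ℓ_j` are nonzero (stated for any decidable predicate
`p` containing the support of `ℓ`).  Otherwise, with `g_j` the degree-`(n-1)` components of the
coefficients, `J = (ℓ_j, g_j : ℓ_j ≠ 0)` has `≤ 4` generators without constant terms and contains
`per_n` and its partial derivatives; a minimal prime of `J` has height `≤ 4` by Krull's height
theorem and `≥ 5` by von zur Gathen's Lemma 2.3 (height form, proved in tree).
[cite: Vonzurgathen1987, Lemma 2.3] -/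
theorem levelled_three_le_card_of_perPoly_mem_span {n : ℕ} (hn : 3 ≤ n) {ι : Type*} [Fintype ι]
    (ℓ : ι → MvPolynomial (Fin n × Fin n) ℂ) (hℓ : ∀ j, (ℓ j).IsHomogeneous 1)
    (hmem : perPoly (Fin n) ℂ ∈ Ideal.span (Set.range ℓ)) (p : ι → Prop) [DecidablePred p]
    (hp : ∀ j, ℓ j ≠ 0 → p j) : 3 ≤ (Finset.univ.filter p).card := by
  classical
  by_contra hlt
  rw [not_le] at hlt
  set s : Finset ι := Finset.univ.filter p with hs
  have hmem_s : ∀ j, ℓ j ≠ 0 → j ∈ s := fun j h => by simp [hs, hp j h]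
  obtain ⟨c, hc⟩ := Ideal.mem_span_range_iff_exists_fun.1 hmem
  -- homogenise the coefficients
  set g : ι → MvPolynomial (Fin n × Fin n) ℂ := fun j => homogeneousComponent (n - 1) (c j)
    with hg
  have hper : perPoly (Fin n) ℂ = ∑ j, ℓ j * g j := by
    have hhom : (perPoly (Fin n) ℂ).IsHomogeneous n := by
      simpa only [Fintype.card_fin] using (perPoly_isHomogeneous (n := Fin n) (k := ℂ))
    calc perPoly (Fin n) ℂ = homogeneousComponent n (perPoly (Fin n) ℂ) :=
          (homogeneousComponent_eq_self hhom).symm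
      _ = ∑ j, homogeneousComponent n (c j * ℓ j) := by rw [← hc, map_sum]
      _ = ∑ j, ℓ j * g j := Finset.sum_congr rfl fun j _ => by
          have h := homogeneousComponent_mul_of_isHomogeneous (hℓ j) (c j) (n - 1)
          rw [show 1 + (n - 1) = n by omega] at h
          rw [mul_comm, h]
  -- the ideal `J = (ℓ_j, g_j : j ∈ s)`
  set G : Finset (MvPolynomial (Fin n × Fin n) ℂ) := s.image ℓ ∪ s.image g with hG
  have hGcard : G.card ≤ 4 :=
    calc G.card ≤ (s.image ℓ).card + (s.image g).card := Finset.card_union_le _ _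
      _ ≤ s.card + s.card := add_le_add Finset.card_image_le Finset.card_image_le
      _ ≤ 4 := by omega
  set J : Ideal (MvPolynomial (Fin n × Fin n) ℂ) := Ideal.span (G : Set _) with hJ
  have hℓJ : ∀ j, ℓ j ∈ J := by
    intro j
    by_cases h : ℓ j = 0
    · rw [h]; exact J.zero_mem
    · exact Ideal.subset_span (Finset.mem_coe.2
        (Finset.mem_union_left _ (Finset.mem_image_of_mem ℓ (hmem_s j h))))
  have hgJ : ∀ j, ℓ j ≠ 0 → g j ∈ J := fun j h =>
    Ideal.subset_span (Finset.mem_coe.2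
      (Finset.mem_union_right _ (Finset.mem_image_of_mem g (hmem_s j h))))
  have hsing : VonZurGathen.singPermIdeal ℂ n ≤ J := by
    rw [VonZurGathen.singPermIdeal, Ideal.span_le]
    rintro f (rfl | ⟨v, rfl⟩)
    · rw [SetLike.mem_coe, hper]
      exact J.sum_mem fun j _ => J.mul_mem_right _ (hℓJ j)
    · simp only [SetLike.mem_coe]
      rw [hper, map_sum]
      refine J.sum_mem fun j _ => ?_
      rw [pderiv_mul]
      refine J.add_mem ?_ (J.mul_mem_right _ (hℓJ j))
      by_cases h : ℓ j = 0
      · simp [h]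
      · exact J.mul_mem_left _ (hgJ j h)
  have hJtop : J ≠ ⊤ := by
    have hle : J ≤ RingHom.ker (constantCoeff : MvPolynomial (Fin n × Fin n) ℂ →+* ℂ) := by
      rw [hJ, Ideal.span_le]
      intro x hx
      rw [Finset.mem_coe, hG, Finset.mem_union, Finset.mem_image, Finset.mem_image] at hx
      rw [SetLike.mem_coe, RingHom.mem_ker]
      rcases hx with ⟨j, -, rfl⟩ | ⟨j, -, rfl⟩
      · exact levelled_constantCoeff_eq_zero_of_isHomogeneous (hℓ j) one_ne_zero
      · exact levelled_constantCoeff_eq_zero_of_isHomogeneous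
          (homogeneousComponent_isHomogeneous (n - 1) (c j)) (by omega)
    intro htop
    have h1 : (1 : MvPolynomial (Fin n × Fin n) ℂ) ∈
        RingHom.ker (constantCoeff : MvPolynomial (Fin n × Fin n) ℂ →+* ℂ) :=
      hle (htop ▸ Submodule.mem_top)
    rw [RingHom.mem_ker, map_one] at h1
    exact one_ne_zero h1
  obtain ⟨⟨P, hP⟩⟩ := Ideal.nonempty_minimalPrimes hJtop
  have h4 : P.height ≤ G.card := Ideal.height_le_card_of_mem_minimalPrimes_span_finset hP
  have hG4 : (G.card : ℕ∞) ≤ 4 := by exact_mod_cast hGcard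
  have h5 : (5 : ℕ∞) ≤ P.height :=
    VonZurGathen.vonzurGathen1987_singPerm_height_holds ℂ two_ne_zero n hn P hP.1.1
      (hsing.trans hP.1.2)
  exact absurd (h5.trans (h4.trans hG4)) (by decide)

/-- **Stub S4 `orbitCorankTwo_levelledCorankTwo`** (line `SketchIdeator1` of
stmt-ValiantsHypothesis-15032; verbatim the body of the route support item `LevelledCorankTwo`,
stmt-ValiantsHypothesis-15033): a levelled (torus-graded) affine determinantal representation
`A = A₀ + L` of `per_n`, `n ≥ 3` — integer weights with `α i + β j = 0` on the support of `A₀` and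
`α i + β j = 1` on the support of `L` — has `adj L = 0` identically.  Proof: module docstring
(zero blocks; `adj A₀ ≠ 0` by von zur Gathen's Thm. 3.1; a level-supported left null vector of
`A₀` and Cramer put `per_n` in the ideal of one column level of `w₀ᵀ L`; that level has `≥ 3`
columns since `per_n ∉ (ℓ₁, ℓ₂)` by Krull + von zur Gathen's Lemma 2.3; count). [folklore] -/
theorem orbitCorankTwo_levelledCorankTwo :
    ∀ n : ℕ, 3 ≤ n → ∀ (m : ℕ) (A : Matrix (Fin m) (Fin m) (MvPolynomial (Fin n × Fin n) ℂ)),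
      IsAffineDetRepr (perPoly (Fin n) ℂ) A → ∀ α β : Fin m → ℤ,
      (∀ i j, MvPolynomial.constantCoeff (A i j) ≠ 0 → α i + β j = 0) →
      (∀ i j, MvPolynomial.homogeneousComponent 1 (A i j) ≠ 0 → α i + β j = 1) →
      (Matrix.of fun a b => MvPolynomial.homogeneousComponent 1 (A a b)).adjugate = 0 := by
  intro n hn m A hA α β h0 h1
  set L : Matrix (Fin m) (Fin m) (MvPolynomial (Fin n × Fin n) ℂ) :=
    Matrix.of fun a b => MvPolynomial.homogeneousComponent 1 (A a b) with hL
  -- (2) von zur Gathen: `adj A₀ ≠ 0` for the constant part `A₀ = A(0)`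
  have hadj0 : (constPart A).adjugate ≠ 0 := by
    intro h
    refine VonZurGathen.false_of_adjugate_eval_eq_zero
      VonZurGathen.vonzurGathen1987_submaximalMinors_height_holds
      VonZurGathen.vonzurGathen1987_singPerm_height_holds (K := ℂ) two_ne_zero hn hA.2
      (w := 0) ?_
    have hmap : (A.map (MvPolynomial.eval (0 : Fin n × Fin n → ℂ))).adjugate =
        A.adjugate.map (MvPolynomial.eval (0 : Fin n × Fin n → ℂ)) := by
      show ((MvPolynomial.eval (0 : Fin n × Fin n → ℂ)).mapMatrix A).adjugate = _
      rw [← RingHom.map_adjugate]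
      rfl
    rw [← hmap, ← constPart_eq_map_eval_zero, h]
  -- hence `N_r(θ) ≤ N_c(θ) + 1` for every level `θ`
  have hF2 : ∀ θ : ℤ, (Finset.univ.filter fun i => -α i ≤ θ).card ≤
      (Finset.univ.filter fun j => β j ≤ θ).card + 1 := by
    intro θ
    by_contra hlt
    rw [not_le] at hlt
    refine hadj0 (levelled_adjugate_eq_zero_of_rowBlock (constPart A)
      (Finset.univ.filter fun i => -α i ≤ θ) (Finset.univ.filter fun j => β j ≤ θ) (by omega)
      fun i j hi hj => ?_)
    simp only [Finset.mem_filter, Finset.mem_univ, true_and, not_le] at hi hj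
    rw [constPart_apply]
    by_contra hne
    have := h0 i j hne
    omega
  -- (3) a left null vector of `A₀` supported on one row level
  have hdet0 : (constPart A).det = 0 := by
    rw [det_constPart, hA.2, constantCoeff_perPoly ℂ (by omega)]
  obtain ⟨w, hw0, hwA⟩ := Matrix.exists_vecMul_eq_zero_iff.2 hdet0
  obtain ⟨i₁, hi₁⟩ : ∃ i, w i ≠ 0 := Function.ne_iff.1 hw0
  set w₀ : Fin m → ℂ := fun i => if α i = α i₁ then w i else 0 with hw₀
  have hA0van : ∀ i j, α i + β j ≠ 0 → constPart A i j = 0 := fun i j hij => by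
    by_contra hne
    exact hij (h0 i j hne)
  have hw₀A : w₀ ᵥ* constPart A = 0 := by
    funext j
    have hwj : ∑ i, w i * constPart A i j = 0 := congrFun hwA j
    show ∑ i, w₀ i * constPart A i j = 0
    by_cases hβ : β j = -α i₁
    · rw [← hwj]
      refine Finset.sum_congr rfl fun i _ => ?_
      simp only [hw₀]
      split_ifs with h
      · rfl
      · rw [hA0van i j (by omega), mul_zero, mul_zero]
    · refine Finset.sum_eq_zero fun i _ => ?_
      simp only [hw₀]
      split_ifs with h
      · rw [hA0van i j (by omega), mul_zero]
      · rw [zero_mul]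
  -- the row `b = w₀ᵀ L` of linear forms, supported on the column level `1 - α i₁`
  set wC : Fin m → MvPolynomial (Fin n × Fin n) ℂ := fun i => C (w₀ i) with hwC
  set b : Fin m → MvPolynomial (Fin n × Fin n) ℂ := wC ᵥ* L with hb
  have hb_apply : ∀ j, b j = ∑ i, C (w₀ i) * homogeneousComponent 1 (A i j) := fun j => rfl
  have hb_hom : ∀ j, (b j).IsHomogeneous 1 := fun j => by
    rw [hb_apply]
    refine IsHomogeneous.sum _ _ _ fun i _ => ?_
    simpa using (isHomogeneous_C _ (w₀ i)).mul (homogeneousComponent_isHomogeneous 1 (A i j))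
  have hb_supp : ∀ j, b j ≠ 0 → β j = 1 - α i₁ := fun j hj => by
    rw [hb_apply] at hj
    obtain ⟨i, -, hi⟩ := Finset.exists_ne_zero_of_sum_ne_zero hj
    have hwi : w₀ i ≠ 0 := fun h => hi (by rw [h, C_0, zero_mul])
    have hLi : homogeneousComponent 1 (A i j) ≠ 0 := fun h => hi (by rw [h, mul_zero])
    have hαi : α i = α i₁ := by
      by_contra h
      exact hwi (by simp [hw₀, h])
    have := h1 i j hLi
    omega
  -- `A = A₀ + L`, `w₀ᵀ A = b`, Cramer: `b · adj A = per_n · w₀ᵀ`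
  have hAdec : A = (constPart A).map C + L := by
    refine Matrix.ext fun i j => ?_
    rw [Matrix.add_apply, Matrix.map_apply, constPart_apply, hL, Matrix.of_apply,
      constantCoeff_eq, ← homogeneousComponent_zero]
    exact eq_homogeneousComponent_zero_add_one (hA.1 i j)
  have hwC0 : wC ᵥ* (constPart A).map C = 0 := by
    funext j
    have h := RingHom.map_vecMul (C : ℂ →+* MvPolynomial (Fin n × Fin n) ℂ) (constPart A) w₀ j
    rw [hw₀A, Pi.zero_apply, map_zero] at h
    show ((⇑(C : ℂ →+* MvPolynomial (Fin n × Fin n) ℂ) ∘ w₀) ᵥ* (constPart A).map C) j = 0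
    exact h.symm
  have hbA : wC ᵥ* A = b := by
    rw [hAdec, Matrix.vecMul_add, hwC0, zero_add]
  have hcramer : b ᵥ* A.adjugate = perPoly (Fin n) ℂ • wC := by
    rw [← hbA, Matrix.vecMul_vecMul, Matrix.mul_adjugate, Matrix.vecMul_smul, Matrix.vecMul_one,
      hA.2]
  have hper_mem : perPoly (Fin n) ℂ ∈ Ideal.span (Set.range b) := by
    have hi : ∑ j, b j * A.adjugate j i₁ = perPoly (Fin n) ℂ * wC i₁ := congrFun hcramer i₁
    have hwCi : wC i₁ = C (w i₁) := by simp [hwC, hw₀]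
    rw [hwCi] at hi
    have key : perPoly (Fin n) ℂ = (∑ j, b j * A.adjugate j i₁) * C (w i₁)⁻¹ := by
      rw [hi, mul_assoc, ← C_mul, mul_inv_cancel₀ hi₁, C_1, mul_one]
    rw [key]
    exact Ideal.mul_mem_right _ _ (Ideal.sum_mem _ fun j _ =>
      Ideal.mul_mem_right _ _ (Ideal.subset_span ⟨j, rfl⟩))
  -- (4) the column level `1 - α i₁` has at least three columns
  have h3 : 3 ≤ (Finset.univ.filter fun j => β j = 1 - α i₁).card :=
    levelled_three_le_card_of_perPoly_mem_span hn b hb_hom hper_mem (fun j => β j = 1 - α i₁)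
      hb_supp
  -- (5) count: the columns of `L` of level `≤ 1 - α i₁` live in the rows of level `≤ -α i₁`
  have hcount := hF2 (-α i₁)
  have hST : (Finset.univ.filter fun i => -α i ≤ -α i₁).card + 2 ≤
      (Finset.univ.filter fun j => β j ≤ 1 - α i₁).card := by
    have hsub : (Finset.univ.filter fun j => β j ≤ -α i₁) ∪
        (Finset.univ.filter fun j => β j = 1 - α i₁) ⊆
        (Finset.univ.filter fun j => β j ≤ 1 - α i₁) := by
      intro j hj
      simp only [Finset.mem_union, Finset.mem_filter, Finset.mem_univ, true_and] at hj ⊢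
      omega
    have hdisj : Disjoint (Finset.univ.filter fun j => β j ≤ -α i₁)
        (Finset.univ.filter fun j => β j = 1 - α i₁) := by
      rw [Finset.disjoint_filter]
      intro j _ h
      omega
    have hle := Finset.card_le_card hsub
    rw [Finset.card_union_of_disjoint hdisj] at hle
    omega
  refine levelled_adjugate_eq_zero_of_colBlock L _ _ hST fun i j hj hi => ?_
  simp only [Finset.mem_filter, Finset.mem_univ, true_and, not_le] at hj hi
  rw [hL, Matrix.of_apply]
  by_contra hne
  have := h1 i j hne
  omega

end Summit.ValiantsHypothesis.Theorems
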